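/-
Copyright (c) 2026. All rights reserved.
Released under Apache 2.0 license as described in the file LICENSE.
Authors: abc-iut cell, wave-4 prover seat abc-iut-w4-d050 (proof-only; over abc-iut-L5-t1's
`GlobalFrobenioidsModel.lean`, L1's [FrdI] Thm 5.2 (ii) and abc-iut-L6-t6's `FrobenioidEquivalence.lean`).
-/
import Literature.IUT.HodgeTheaters.GlobalFrobenioidsModelFrobenioid
import Literature.AlgebraicGeometry.Frobenioids.FrobenioidEquivalence
import Literature.AlgebraicGeometry.Frobenioids.FiberProductsFrobenioid
import HarnessLib

/-!
# [IUTchI] Example 5.1 (iii): `†ℱ^⊛` "is equipped with a natural Frobenioid structure" — PROVED at the divisor data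

S. Mochizuki, *Inter-universal Teichmüller theory I*, §5, Example 5.1 (iii) (kurims manuscript, May
2020, p. 125): "Let `†ℱ^⊛` be any category equivalent to `ℱ^⊛(†𝒟^⊚)`.  Thus, `†ℱ^⊛` is equipped with a
natural Frobenioid structure [cf. [FrdI], Corollary 4.11; [FrdI], Theorem 6.4, (i); Remark 3.1.5 of
the present paper]".

Seat abc-iut-L5-t1 typed `†ℱ^⊛` as the structure `GlobalFrobenioid Δ Dcirc toBase0` whose field
`equiv : cat ≌ Δ.ModelGlobalFrobenioid` records "equivalent to `ℱ^⊛(†𝒟^⊚)`" (`GlobalFrobenioidsModel.lean`,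
p404939), leaving the Frobenioid structure as DATA.  The structure functor that the equivalence
induces is `F.equiv.functor ⋙ (ℱ^⊛(†𝒟^⊚) → F_{Φ^⊛})`; this PROOF-ONLY file shows it IS a Frobenioid
(of isotropic type) under the printed [FrdI] Thm 5.2 hypotheses on the divisor data `(Φ^⊛, 𝔹)` —
`Φ^⊛` divisorial, `𝔹` group-like, supplied in print by [FrdI] Ex 6.3 and kept BY NAME because
`GlobalDivisorData` carries no such fields — by composing

* `GlobalDivisorData.isFrobenioid_model` (`GlobalFrobenioidsModelFrobenioid.lean`: [FrdI] Thm 5.2 (ii)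
  for `ℱ^⊛(†𝒟^⊚)` over `†𝒟^⊛ = ℬ(G)⁰`, base hypotheses discharged), with
* abc-iut-L6-t6's "a category equivalent to a Frobenioid is a Frobenioid"
  (`PreFrobenioid.IsFrobenioid.comp_equivalence`, `FrobenioidEquivalence.lean` — whose docstring names
  exactly this use: "[IUTchI] Ex. 5.1 (iii)").

Finally `†ℱ^⊚ := †ℱ^⊛|_{†𝒟^⊚}` ("the restriction of `†ℱ^⊛` to `†𝒟^⊚` via the natural morphism
`†𝒟^⊚ → †𝒟^⊛`", pp. 125–126; (vi): "the discussion … may also be carried out for `†ℱ^⊚, †𝒟^⊚`") is, in the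
presentation of [FrdI] §0 / Prop 1.6 over the IDENTIFIED base `Base(†ℱ^⊛) ⥲ †𝒟^⊛` (t1's `identify`), the
categorical fibre product `†ℱ^⊛ ×_{†𝒟^⊛} †𝒟^⊚` of L1's `PreFrobenioid.FiberProduct` along
`†𝒟^⊚ → Base(†ℱ^⊛) ⥲ †𝒟^⊛`; by abc-iut-found's [FrdI] Prop 1.6 (ii) (`PreFrobenioid.isFrobenioid_fiberProduct`,
`FiberProductsFrobenioid.lean`) it is a Frobenioid over `†𝒟^⊚` as soon as `†𝒟^⊚` is connected and
totally epimorphic and `†𝒟^⊚ → †𝒟^⊛` maps FSM-morphisms to FSM-morphisms (the printed hypotheses of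
Prop 1.6, true for `ℬ(π₁(†𝒟^⊚))⁰ → ℬ(π₁(†𝒟^⊛))⁰` but HYPOTHESES here because t1's `Dcirc`/`toBase0` are
abstract parameters) — `isFrobenioid_fiberProductOverIdentify`.  t1's own `GlobalFrobenioid.Fcirc` is the
fibre product over the UN-identified base `toBase`/`baseMor`; the transport along `identify` /
`toBase_compat` is carried out here as an identity-on-components equivalence
(`exists_fcirc_equivalence_fiberProduct`), whence `fcirc_isFrobenioid`: t1's literal `†ℱ^⊚`, with the
structure functor induced through that equivalence, IS a Frobenioid (same hypotheses).

Theorems only; no definitions; no new named facts; nothing here bears on [IUTchIII] Cor. 3.12.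
[claim: Mochizuki2012, status: disputed] for the reading of (iii)/(vi); the mathematics is L1's
[cite: MochizukiFrdI2008, Thm. 5.2(ii) p.101], [cite: MochizukiFrdI2008, Def. 1.3 p.24] and
[cite: MochizukiFrdI2008, Prop. 1.6 p.27].
-/

namespace Literature.IUT.HodgeTheaters

open CategoryTheory Literature.AlgebraicGeometry.Frobenioids

universe u

namespace GlobalFrobenioid

variable {G : ProfiniteGrp.{u}} {Δ : GlobalDivisorData G} {Dcirc : Type (u + 1)}
  [Category.{u} Dcirc] {toBase0 : Dcirc ⥤ BaseCat G} (F : GlobalFrobenioid Δ Dcirc toBase0)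

/-- **[IUTchI] Ex 5.1 (iii), "`†ℱ^⊛` is equipped with a natural Frobenioid structure"** (p. 125), PROVED
at the divisor data: for `Φ^⊛` a divisorial monoid and `𝔹` a group-like monoid on `†𝒟^⊛` ([FrdI] Thm 5.2
hypotheses, as [FrdI] Ex 6.3 provides), the structure functor `†ℱ^⊛ → ℱ^⊛(†𝒟^⊚) → F_{Φ^⊛}` induced by the
given equivalence `†ℱ^⊛ ≌ ℱ^⊛(†𝒟^⊚)` is a Frobenioid ([FrdI] Def 1.3 (i)–(vii)).
([IUTchI] Ex 5.1 (iii) p.125) [claim: Mochizuki2012, status: disputed] -/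
theorem isFrobenioid_equivToElem (hΦ : IsMonoidOn Δ.Φ)
    (hΦd : Objectwise (fun M _ => IsDivisorial M) Δ.Φ) (hB : IsMonoidOn Δ.B)
    (hBg : Objectwise (fun M _ => IsGroupLike M) Δ.B) :
    PreFrobenioid.IsFrobenioid (F.equiv.functor ⋙ ModelFrobenioid.toElem Δ.Φ Δ.B Δ.div) :=
  PreFrobenioid.IsFrobenioid.comp_equivalence F.equiv (Δ.isFrobenioid_model hΦ hΦd hB hBg)

/-- … and that Frobenioid structure on `†ℱ^⊛` is of ISOTROPIC type ([FrdI] Thm 5.2 (ii) "of isotropic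
type", transported along the equivalence) whenever `𝔹` is group-like.
([IUTchI] Ex 5.1 (iii) p.125) [claim: Mochizuki2012, status: disputed] -/
theorem isOfIsotropicType_equivToElem (hBg : Objectwise (fun M _ => IsGroupLike M) Δ.B) :
    PreFrobenioid.IsOfIsotropicType (F.equiv.functor ⋙ ModelFrobenioid.toElem Δ.Φ Δ.B Δ.div) :=
  PreFrobenioid.isOfIsotropicType_comp_equivalence F.equiv (Δ.isOfIsotropicType_model hBg)

/-- In particular `†ℱ^⊛` with that structure is a PRE-Frobenioid ([FrdI] Def 1.1 (iv)): the underlying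
category `†ℱ^⊛` is connected and totally epimorphic and the divisor monoid is as required — the
bookkeeping half of "natural Frobenioid structure". ([IUTchI] Ex 5.1 (iii) p.125) [claim: Mochizuki2012, status: disputed] -/
theorem isPreFrobenioid_equivToElem (hΦ : IsMonoidOn Δ.Φ)
    (hΦd : Objectwise (fun M _ => IsDivisorial M) Δ.Φ) (hB : IsMonoidOn Δ.B)
    (hBg : Objectwise (fun M _ => IsGroupLike M) Δ.B) :
    IsPreFrobenioid Δ.Φ (F.equiv.functor ⋙ ModelFrobenioid.toElem Δ.Φ Δ.B Δ.div) :=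
  (F.isFrobenioid_equivToElem hΦ hΦd hB hBg).isPreFrobenioid

/-- **`†ℱ^⊚ := †ℱ^⊛|_{†𝒟^⊚}` is a Frobenioid over `†𝒟^⊚`** ([IUTchI] Ex 5.1 (iii) p.125–126 with (vi) p.130),
in the [FrdI] §0 / Prop 1.6 presentation over the identified base: the categorical fibre product of
`†ℱ^⊛ → ℱ^⊛(†𝒟^⊚) → †𝒟^⊛` with `†𝒟^⊚ → Base(†ℱ^⊛) ⥲ †𝒟^⊛` (t1's `baseMor ⋙ identify.functor`), with its
[FrdI] Prop 1.6 (ii) structure functor to `F_{Φ^⊛|_{†𝒟^⊚}}`, is a Frobenioid — under the printed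
[FrdI] Thm 5.2 hypotheses on `(Φ^⊛, 𝔹)` and the printed [FrdI] Prop 1.6 hypotheses on `†𝒟^⊚ → †𝒟^⊛`
(connected, totally epimorphic source; FSM-morphisms to FSM-morphisms), all BY NAME.
([IUTchI] Ex 5.1 (iii) p.125) [claim: Mochizuki2012, status: disputed] -/
theorem isFrobenioid_fiberProductOverIdentify (hΦ : IsMonoidOn Δ.Φ)
    (hΦd : Objectwise (fun M _ => IsDivisorial M) Δ.Φ) (hB : IsMonoidOn Δ.B)
    (hBg : Objectwise (fun M _ => IsGroupLike M) Δ.B) (hDc : IsGraphConnected Dcirc)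
    (hDe : IsTotallyEpimorphic Dcirc)
    (hFSM : ∀ {A A' : Dcirc} (f : A' ⟶ A), IsFSM f → IsFSM ((F.baseMor ⋙ F.identify.functor).map f)) :
    PreFrobenioid.IsFrobenioid
      (PreFrobenioid.fiberProductFunctor (F.equiv.functor ⋙ ModelFrobenioid.toElem Δ.Φ Δ.B Δ.div)
        (F.baseMor ⋙ F.identify.functor)) :=
  PreFrobenioid.isFrobenioid_fiberProduct (F.isFrobenioid_equivToElem hΦ hΦd hB hBg) hDc hDe hFSM

/-- **t1's literal `†ℱ^⊚ = GlobalFrobenioid.Fcirc` versus the [FrdI] Prop 1.6 fibre product.**  `†ℱ^⊚` was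
typed (GlobalFrobenioidsModel.lean) as the §0 fibre product `CFP toBase baseMor` over the UN-identified base
`Base(†ℱ^⊛)`; L1's `PreFrobenioid.FiberProduct` of the structure functor `†ℱ^⊛ → F_{Φ^⊛}` with
`†𝒟^⊚ → Base(†ℱ^⊛) ⥲ †𝒟^⊛` is the same fibre product over the IDENTIFIED base.  Transport along t1's
`identify : Base(†ℱ^⊛) ≌ †𝒟^⊛` and `toBase_compat : toBase ⋙ identify ≅ equiv ⋙ (ℱ^⊛(†𝒟^⊚) → †𝒟^⊛)` gives an
equivalence of categories between the two which is the IDENTITY on both components `(A, A′)` of every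
object (only the gluing isomorphism `α` is re-expressed through `identify`) — pure bookkeeping, recorded
as an existence statement so that this file stays definition-free. ([IUTchI] Ex 5.1 (iii) p.125) [claim: Mochizuki2012, status: disputed] -/
theorem exists_fcirc_equivalence_fiberProduct :
    ∃ e : F.Fcirc ≌ PreFrobenioid.FiberProduct
        (F.equiv.functor ⋙ ModelFrobenioid.toElem Δ.Φ Δ.B Δ.div) (F.baseMor ⋙ F.identify.functor),
      ∀ X, (e.functor.obj X).fst = X.fst ∧ (e.functor.obj X).snd = X.snd := by
  let S := F.equiv.functor ⋙ ModelFrobenioid.toElem Δ.Φ Δ.B Δ.div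
  let G' := F.baseMor ⋙ F.identify.functor
  let I := F.identify.functor
  -- the identification `Base(†ℱ^⊛) ⥲ †𝒟^⊛` on objects of `†ℱ^⊛`, with normalised types
  let cI : ∀ A : F.cat, I.obj (F.toBase.obj A) ≅ Δ.modelBase.obj (F.equiv.functor.obj A) :=
    fun A => F.toBase_compat.app A
  have hn : ∀ {A A' : F.cat} (f : A ⟶ A'),
      I.map (F.toBase.map f) ≫ (cI A').hom = (cI A).hom ≫ Δ.modelBase.map (F.equiv.functor.map f) :=
    fun f => F.toBase_compat.hom.naturality f
  have hn' : ∀ {A A' : F.cat} (f : A ⟶ A'),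
      Δ.modelBase.map (F.equiv.functor.map f) ≫ (cI A').inv = (cI A).inv ≫ I.map (F.toBase.map f) :=
    fun f => F.toBase_compat.inv.naturality f
  -- forward functor
  let fwd : F.Fcirc ⥤ PreFrobenioid.FiberProduct S G' :=
    { obj := fun X => ⟨X.fst, X.snd, (cI X.fst).symm ≪≫ I.mapIso X.iso⟩
      map := fun {X Y} f => ⟨f.fst, f.snd, by
        change Δ.modelBase.map (F.equiv.functor.map f.fst) ≫ ((cI Y.fst).inv ≫ I.map Y.iso.hom) =
          ((cI X.fst).inv ≫ I.map X.iso.hom) ≫ I.map (F.baseMor.map f.snd)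
        rw [← Category.assoc, hn' f.fst, Category.assoc, Category.assoc, ← I.map_comp, ← I.map_comp,
          f.w]⟩
      map_id := fun X => CFP.hom_ext rfl rfl
      map_comp := fun f g => CFP.hom_ext rfl rfl }
  -- backward functor
  let bwd : PreFrobenioid.FiberProduct S G' ⥤ F.Fcirc :=
    { obj := fun Y => ⟨Y.fst, Y.snd, I.preimageIso (cI Y.fst ≪≫ Y.iso)⟩
      map := fun {X Y} g => ⟨g.fst, g.snd, I.map_injective (by
        have hw : (Δ.modelBase.map (F.equiv.functor.map g.fst) ≫ Y.iso.hom :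
              Δ.modelBase.obj (F.equiv.functor.obj X.fst) ⟶ I.obj (F.baseMor.obj Y.snd)) =
            X.iso.hom ≫ I.map (F.baseMor.map g.snd) := g.w
        change I.map (F.toBase.map g.fst ≫ I.preimage ((cI Y.fst).hom ≫ Y.iso.hom)) =
          I.map (I.preimage ((cI X.fst).hom ≫ X.iso.hom) ≫ F.baseMor.map g.snd)
        rw [I.map_comp, I.map_comp, I.map_preimage, I.map_preimage, ← Category.assoc, hn g.fst,
          Category.assoc, hw, Category.assoc]
        rfl)⟩
      map_id := fun X => CFP.hom_ext rfl rfl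
      map_comp := fun f g => CFP.hom_ext rfl rfl }
  -- unit and counit, identity on components
  let η : 𝟭 F.Fcirc ≅ fwd ⋙ bwd := NatIso.ofComponents
    (fun X => CFP.isoMk (Iso.refl _) (Iso.refl _) (by
      change F.toBase.map (𝟙 _) ≫ I.preimage ((cI X.fst).hom ≫ ((cI X.fst).inv ≫ I.map X.iso.hom)) =
        X.iso.hom ≫ F.baseMor.map (𝟙 _)
      rw [F.toBase.map_id, F.baseMor.map_id, Category.id_comp, Category.comp_id,
        Iso.hom_inv_id_assoc, Functor.preimage_map]))
    (fun {X Y} f => CFP.hom_ext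
      (by change f.fst ≫ 𝟙 _ = 𝟙 _ ≫ f.fst; rw [Category.comp_id, Category.id_comp])
      (by change f.snd ≫ 𝟙 _ = 𝟙 _ ≫ f.snd; rw [Category.comp_id, Category.id_comp]))
  let ε : bwd ⋙ fwd ≅ 𝟭 _ := NatIso.ofComponents
    (fun Y => CFP.isoMk (Iso.refl _) (Iso.refl _) (by
      change Δ.modelBase.map (F.equiv.functor.map (𝟙 _)) ≫ Y.iso.hom =
        ((cI Y.fst).inv ≫ I.map (I.preimage ((cI Y.fst).hom ≫ Y.iso.hom))) ≫ I.map (F.baseMor.map (𝟙 _))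
      rw [F.equiv.functor.map_id, Δ.modelBase.map_id, Category.id_comp, F.baseMor.map_id, I.map_id,
        Category.comp_id, Functor.map_preimage, Iso.inv_hom_id_assoc]))
    (fun {X Y} f => CFP.hom_ext
      (by change f.fst ≫ 𝟙 _ = 𝟙 _ ≫ f.fst; rw [Category.comp_id, Category.id_comp])
      (by change f.snd ≫ 𝟙 _ = 𝟙 _ ≫ f.snd; rw [Category.comp_id, Category.id_comp]))
  exact ⟨CategoryTheory.Equivalence.mk fwd bwd η ε, fun X => ⟨rfl, rfl⟩⟩

/-- **[IUTchI] Ex 5.1 (iii)/(vi): t1's `†ℱ^⊚ := †ℱ^⊛|_{†𝒟^⊚}` IS a Frobenioid over `†𝒟^⊚`** (pp. 125–126, 130):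
composing the bookkeeping equivalence `exists_fcirc_equivalence_fiberProduct` with [FrdI] Prop 1.6 (ii)
(`isFrobenioid_fiberProductOverIdentify`) and "a category equivalent to a Frobenioid is a Frobenioid"
(`PreFrobenioid.IsFrobenioid.comp_equivalence`): there is an equivalence `e` from `†ℱ^⊚` to the Prop 1.6
fibre product, identity on components, such that the induced structure functor
`†ℱ^⊚ → F_{Φ^⊛|_{†𝒟^⊚}}` is a Frobenioid — under the printed [FrdI] Thm 5.2 hypotheses on `(Φ^⊛, 𝔹)` and the
printed [FrdI] Prop 1.6 hypotheses on `†𝒟^⊚ → †𝒟^⊛`, all BY NAME.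
([IUTchI] Ex 5.1 (iii) p.125) [claim: Mochizuki2012, status: disputed] -/
theorem fcirc_isFrobenioid (hΦ : IsMonoidOn Δ.Φ)
    (hΦd : Objectwise (fun M _ => IsDivisorial M) Δ.Φ) (hB : IsMonoidOn Δ.B)
    (hBg : Objectwise (fun M _ => IsGroupLike M) Δ.B) (hDc : IsGraphConnected Dcirc)
    (hDe : IsTotallyEpimorphic Dcirc)
    (hFSM : ∀ {A A' : Dcirc} (f : A' ⟶ A), IsFSM f → IsFSM ((F.baseMor ⋙ F.identify.functor).map f)) :
    ∃ e : F.Fcirc ≌ PreFrobenioid.FiberProduct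
        (F.equiv.functor ⋙ ModelFrobenioid.toElem Δ.Φ Δ.B Δ.div) (F.baseMor ⋙ F.identify.functor),
      (∀ X, (e.functor.obj X).fst = X.fst ∧ (e.functor.obj X).snd = X.snd) ∧
      PreFrobenioid.IsFrobenioid (e.functor ⋙ PreFrobenioid.fiberProductFunctor
        (F.equiv.functor ⋙ ModelFrobenioid.toElem Δ.Φ Δ.B Δ.div) (F.baseMor ⋙ F.identify.functor)) := by
  obtain ⟨e, he⟩ := F.exists_fcirc_equivalence_fiberProduct
  exact ⟨e, he, PreFrobenioid.IsFrobenioid.comp_equivalence e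
    (F.isFrobenioid_fiberProductOverIdentify hΦ hΦd hB hBg hDc hDe hFSM)⟩

end GlobalFrobenioid

end Literature.IUT.HodgeTheaters
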